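import Literature.Computability.Cryptography.VanDamSeroussiCubicBlock
import Literature.Computability.Cryptography.VanDamSeroussiReplicatedFourier
import Literature.Computability.Cryptography.KitaevPhaseReconstruction
import Literature.Computability.QuantumComplexity.PolyCopies
import HarnessLib

/-!
# The cubic Gauss-sum experiment: sizes, indices and the pure post-processing functions

Topic `Literature/Computability/Cryptography`; companion of `VanDamSeroussiCubicBlock.lean`. The
elementary (quantum-free) data of the experiment proving `VanDamSeroussi2002_cubicGaussSumPhase_qsolvable`:
the sizes `λ, B` and the layout `lay t n'` on inputs of length `n'`, a polynomial bound of the block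
width (`widthBound`, `Wd_le_widthBound`), the re-encoded input `encIn p r`, the index type `Idx` of
the `36` counts, the integer post-processing `Post.outM` (statistics `D`, groups `RA, IA`, rounded
scores, first maximiser), and the string-level readers (`Layout.freqOfL`, `Layout.classOK`,
`Layout.evL`, `cntS`). Their meaning is established in `VanDamSeroussiCubicCopies.lean`,
`…Post.lean`, `…PostStr.lean`; their polynomial-time computability in `…PostFP.lean`. Everything here
is a definition or a proved lemma; no named fact is introduced.

## References

* W. van Dam, G. Seroussi, arXiv:quant-ph/0207131 (2002), §4 Thm. 1 [VanDamSeroussi2002].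
* A. Yu. Kitaev, arXiv:quant-ph/9511026 (1995), §3 [Kitaev1995].
-/

noncomputable section

namespace Literature.Computability.Cryptography

namespace VanDamSeroussi

namespace CubicBlock

open _root_.Computability Complexity QuantumComplexity QuantumComplexity.RevSim QuantumComplexity.RevClean Kitaev1995 Finset
open Literature.Computability.Complexity.ModArith (powM)
open Real (pi)
open scoped Real

/-! ### The sizes of the experiment -/

section Sizes

/-- `λ`: `2^λ` repetitions, `λ = n + 18 + 4(⌊log₂ t⌋ + 1)`. [cite: VanDamSeroussi2002, §4 Thm. 1 (proof)] -/
def lamOf (t n : ℕ) : ℕ := n + 18 + 4 * (Nat.log 2 t + 1)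

/-- `B`: tests per level and kind, `2^18 κ t² + 1`. [cite: Kitaev1995, §3 (before Lemma 9)] -/
def BOf (t n : ℕ) : ℕ := 2 ^ 18 * (lamOf t n + n + 3) * t ^ 2 + 1

/-- The layout of the block on inputs of length `n'` (`n = ⌊n'/2⌋`). [folklore] -/
def lay (t n' : ℕ) : Layout := ⟨n' / 2, lamOf t (n' / 2), BOf t (n' / 2)⟩

/-- A generous linear size: `D = n' + (λ − n) + 8`. [folklore] -/
def Dsz (t n' : ℕ) : ℕ := n' + (18 + 4 * (Nat.log 2 t + 1)) + 8

/-- The generous polynomial bound `2^21 (t² + 1) (X + const)²`. [folklore] -/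
def bigPoly (t : ℕ) : Polynomial ℕ :=
  Polynomial.C (2 ^ 21 * (t ^ 2 + 1)) * (Polynomial.X + Polynomial.C ((18 + 4 * (Nat.log 2 t + 1)) + 8)) ^ 2

/-- Value of `bigPoly`. [folklore] -/
theorem eval_bigPoly (t n' : ℕ) : (bigPoly t).eval n' = 2 ^ 21 * (t ^ 2 + 1) * Dsz t n' ^ 2 := by
  simp [bigPoly, Dsz, add_assoc]

/-- Evaluation of an `ℕ`-polynomial is monotone. [folklore] -/
theorem eval_mono (q : Polynomial ℕ) {a b : ℕ} (h : a ≤ b) : q.eval a ≤ q.eval b := by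
  rw [Polynomial.eval_eq_sum_range, Polynomial.eval_eq_sum_range]
  exact Finset.sum_le_sum fun i _ => Nat.mul_le_mul_left _ (Nat.pow_le_pow_left h i)

/-- **All block sizes are below the generous bound.** [folklore] -/
theorem sizes_le_big (t n' : ℕ) :
    (lay t n').as ≤ (bigPoly t).eval n' ∧ (lay t n').aLen₁ ≤ (bigPoly t).eval n' ∧ (lay t n').aLen₂ ≤ (bigPoly t).eval n' ∧
      (lay t n').aLen₃ ≤ (bigPoly t).eval n' ∧ (lay t n').aLen₄ ≤ (bigPoly t).eval n' ∧
      (lay t n').k + ((lay t n').kap + (lay t n').kap) ≤ (bigPoly t).eval n' := by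
  obtain ⟨D, hD⟩ : ∃ D, D = Dsz t n' := ⟨_, rfl⟩
  rw [eval_bigPoly, ← hD]
  have hn : n' / 2 ≤ n' := Nat.div_le_self _ _
  have hkap : (lay t n').kap ≤ D := by
    show lamOf t (n' / 2) + n' / 2 + 3 ≤ D; unfold lamOf; rw [hD, Dsz]; omega
  have hD8 : 8 ≤ D := by rw [hD, Dsz]; omega
  have ht2 : t ^ 2 ≤ t ^ 2 + 1 := Nat.le_succ _
  have hB : (lay t n').B ≤ 2 ^ 18 * D * (t ^ 2 + 1) := by
    show 2 ^ 18 * (lamOf t (n' / 2) + n' / 2 + 3) * t ^ 2 + 1 ≤ _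
    have : 2 ^ 18 * (lamOf t (n' / 2) + n' / 2 + 3) * t ^ 2 ≤ 2 ^ 18 * D * t ^ 2 := by
      have : lamOf t (n' / 2) + n' / 2 + 3 ≤ D := hkap
      gcongr
    nlinarith
  have hBper : (lay t n').Bper ≤ 2 ^ 19 * D * (t ^ 2 + 1) := by
    show 2 * (lay t n').B ≤ _
    have : 2 * (2 ^ 18 * D * (t ^ 2 + 1)) = 2 ^ 19 * D * (t ^ 2 + 1) := by ring
    omega
  have hwB : (lay t n').wB ≤ 2 ^ 19 * D * (t ^ 2 + 1) + 1 := by show (lay t n').Bper + 1 ≤ _; omega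
  have hk : (lay t n').k ≤ 2 ^ 19 * D ^ 2 * (t ^ 2 + 1) := by
    show (lay t n').kap * (lay t n').Bper ≤ _
    calc (lay t n').kap * (lay t n').Bper ≤ D * (2 ^ 19 * D * (t ^ 2 + 1)) := Nat.mul_le_mul hkap hBper
      _ = _ := by ring
  have hn2 : (lay t n').n ≤ D := by show n' / 2 ≤ D; rw [hD, Dsz]; omega
  have hlam : (lay t n').lam ≤ D := by show lamOf t (n' / 2) ≤ D; unfold lamOf; rw [hD, Dsz]; omega
  have hkap' : (lay t n').kap = (lay t n').lam + (lay t n').n + 3 := rfl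
  have hcs : (lay t n').cs ≤ 4 * D := by
    show (lay t n').ℓ + 3 + (lay t n').n + (lay t n').lam ≤ _
    have : (lay t n').ℓ = 2 * (lay t n').n := rfl
    omega
  have has : (lay t n').as ≤ 6 * D + 5 + 2 ^ 19 * D * (t ^ 2 + 1) := by
    show (lay t n').cs + (lay t n').n + (lay t n').kap + 4 + (lay t n').wB ≤ _; omega
  have hP64 : 64 ≤ D ^ 2 * (t ^ 2 + 1) := by nlinarith
  have hDP : D ≤ D ^ 2 * (t ^ 2 + 1) := by nlinarith
  have hQP : D * (t ^ 2 + 1) ≤ D ^ 2 * (t ^ 2 + 1) := by nlinarith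
  have hR : 2 ^ 21 * (t ^ 2 + 1) * D ^ 2 = 2 ^ 21 * (D ^ 2 * (t ^ 2 + 1)) := by ring
  have hk' : (lay t n').k ≤ 2 ^ 19 * (D ^ 2 * (t ^ 2 + 1)) := by rw [← mul_assoc]; exact hk
  have hwB' : (lay t n').wB ≤ 2 ^ 19 * (D * (t ^ 2 + 1)) + 1 := by rw [← mul_assoc]; exact hwB
  have has' : (lay t n').as ≤ 6 * D + 5 + 2 ^ 19 * (D * (t ^ 2 + 1)) := by rw [← mul_assoc]; exact has
  rw [hR]
  have e1 : (lay t n').aLen₁ = 2 * 1 + 2 + (2 * (lay t n').n + 2 + (2 * (lay t n').n + 2 + (2 * (lay t n').n + 2 + 2))) := rfl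
  have e2 : (lay t n').aLen₂ = 2 * (lay t n').n + 2 + (2 * (lay t n').lam + 2 + (lay t n').n) := rfl
  have e3 : (lay t n').aLen₃ = 2 * (lay t n').kap + 2 + (2 * (lay t n').n + 2 + ((lay t n').n + 1)) := rfl
  have e4 : (lay t n').aLen₄ = 2 * (lay t n').kap + 2 + (2 * (lay t n').k + 2 + (2 * ((lay t n').kap + 1) + 2 + (lay t n').wB)) := rfl
  rw [e1, e2, e3, e4]
  refine ⟨?_, ?_, ?_, ?_, ?_, ?_⟩ <;> omega

/-- **A polynomial bound of the block width.** [folklore] -/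
def widthBound (t : ℕ) : Polynomial ℕ :=
  bigPoly t + bigPoly t + ((RevClean.widthPoly mach₁.e mach₁.M).comp (bigPoly t) + (RevClean.widthPoly mach₂.e mach₂.M).comp (bigPoly t) +
    (RevClean.widthPoly mach₃.e mach₃.M).comp (bigPoly t) + (RevClean.widthPoly mach₄.e mach₄.M).comp (bigPoly t) +
    (RevClean.widthPoly mach₅.e mach₅.M).comp (bigPoly t))

/-- **The block width is polynomially bounded.** [folklore] -/
theorem Wd_le_widthBound (t n' : ℕ) : (lay t n').Wd ≤ (widthBound t).eval n' := by
  obtain ⟨has, h1, h2, h3, h4, hk⟩ := sizes_le_big t n'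
  have e : (lay t n').Wd = (lay t n').as + (width mach₁.e mach₁.M (lay t n').aLen₁ + width mach₂.e mach₂.M (lay t n').aLen₂ +
      width mach₃.e mach₃.M (lay t n').aLen₃ + width mach₄.e mach₄.M (lay t n').aLen₄ + width mach₅.e mach₅.M (lay t n').aLen₄) +
      ((lay t n').k + ((lay t n').kap + (lay t n').kap)) := rfl
  rw [e, widthBound]
  simp only [Polynomial.eval_add, Polynomial.eval_comp, RevClean.eval_widthPoly]
  have m1 := eval_mono (RevClean.widthPoly mach₁.e mach₁.M) h1
  have m2 := eval_mono (RevClean.widthPoly mach₂.e mach₂.M) h2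
  have m3 := eval_mono (RevClean.widthPoly mach₃.e mach₃.M) h3
  have m4 := eval_mono (RevClean.widthPoly mach₄.e mach₄.M) h4
  have m5 := eval_mono (RevClean.widthPoly mach₅.e mach₅.M) h4
  simp only [RevClean.eval_widthPoly] at m1 m2 m3 m4 m5
  omega

/-- The input fits below the block width. [folklore] -/
theorem le_Wd (t n' : ℕ) : n' ≤ (lay t n').Wd := by
  have h1 := (lay t n').as_le_n₁
  have h2 : (lay t n').cs ≤ (lay t n').as := by unfold Layout.as; omega
  have h3 : n' ≤ (lay t n').cs := by
    show n' ≤ (lay t n').ℓ + 3 + (lay t n').n + (lay t n').lam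
    have : (lay t n').ℓ = 2 * (n' / 2) := rfl
    omega
  have : (lay t n').n₁ ≤ (lay t n').Wd := Nat.le_add_right _ _
  omega

end Sizes

/-! ### The re-encoded input -/

/-- **The re-encoded input**: `n` bits of `p` then `n` bits of `r mod p`, `n` the bit size of `p`.
[cite: VanDamSeroussi2002, §4 Algorithm 1 (input)] -/
def encIn (p r : ℕ) : List Bool := Layout.bitsLE p p.size ++ Layout.bitsLE (r % p) p.size

/-- The length of the re-encoded input is `2 · size p`. [folklore] -/
theorem length_encIn (p r : ℕ) : (encIn p r).length = 2 * p.size := by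
  simp [encIn, Layout.bitsLE]; ring

/-- The layout of the experiment on `(p, r)`. [folklore] -/
abbrev layPR (t p r : ℕ) : Layout := lay t (encIn p r).length

/-- The layout on the re-encoded input has `n = size p`. [folklore] -/
theorem layPR_n (t p r : ℕ) : (layPR t p r).n = p.size := by
  show (encIn p r).length / 2 = p.size; rw [length_encIn]; omega

/-- The re-encoded input fits below the first part. [folklore] -/
theorem length_encIn_le_n₁ (t p r : ℕ) : (encIn p r).length ≤ (layPR t p r).n₁ := by
  have h1 := (layPR t p r).as_le_n₁
  have h3 : (encIn p r).length ≤ (layPR t p r).cs := by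
    show (encIn p r).length ≤ (layPR t p r).ℓ + 3 + (layPR t p r).n + (layPR t p r).lam
    have : (layPR t p r).ℓ = 2 * ((encIn p r).length / 2) := rfl
    omega
  have : (layPR t p r).cs ≤ (layPR t p r).as := by unfold Layout.as; omega
  omega

/-- The index of a count: class `c`, coset `c'`, coin `τ`, control `b`. [folklore] -/
abbrev Idx : Type := Fin 3 × Fin 3 × Bool × Bool

/-! ### The integer statistics -/

namespace Post

/-- The control statistic of `(c, c', τ)`: `#(control 0) − #(control 1)`. [cite: VanDamSeroussi2002, §4 Thm. 1 (proof)] -/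
def D (C : Idx → ℕ) (c c' : Fin 3) (im : Bool) : ℤ := (C (c, c', im, false) : ℤ) - C (c, c', im, true)

/-- The real parts grouped by `(c + c') mod 3`. [folklore] -/
def RA (C : Idx → ℕ) (k : ℕ) : ℤ := ∑ c : Fin 3, ∑ c' : Fin 3, if ((c : ℕ) + c') % 3 = k then D C c c' false else 0

/-- The imaginary parts grouped by `(c + c') mod 3`. [folklore] -/
def IA (C : Idx → ℕ) (k : ℕ) : ℤ := ∑ c : Fin 3, ∑ c' : Fin 3, if ((c : ℕ) + c') % 3 = k then D C c c' true else 0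

/-- The fixed integer constants of the post-processor for `t`: bits `m`, and `2^m`-scaled
approximations of `√3` and of `cos, sin (2πj/4t)`. [folklore] -/
structure Consts where
  /-- bits of precision -/
  m : ℕ
  /-- `≈ 2^m √3` -/
  S3 : ℤ
  /-- `≈ 2^m cos(2πj/4t)` -/
  Cc : ℕ → ℤ
  /-- `≈ 2^m sin(2πj/4t)` -/
  Sc : ℕ → ℤ

/-- Accuracy of the constants. [folklore] -/
structure Consts.OK (t : ℕ) (cs : Consts) : Prop where
  /-- `√3` -/
  s3 : |(cs.S3 : ℝ) - 2 ^ cs.m * Real.sqrt 3| ≤ 1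
  /-- cosines -/
  cc : ∀ j, j < 4 * t → |(cs.Cc j : ℝ) - 2 ^ cs.m * Real.cos (2 * π * j / (4 * t : ℕ))| ≤ 1
  /-- sines -/
  sc : ∀ j, j < 4 * t → |(cs.Sc j : ℝ) - 2 ^ cs.m * Real.sin (2 * π * j / (4 * t : ℕ))| ≤ 1

/-- **Accurate constants exist** (floors). [folklore] -/
theorem exists_consts (t m : ℕ) : ∃ cs : Consts, cs.m = m ∧ cs.OK t :=
  ⟨⟨m, ⌊(2 : ℝ) ^ m * Real.sqrt 3⌋, fun j => ⌊(2 : ℝ) ^ m * Real.cos (2 * π * j / (4 * t : ℕ))⌋,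
    fun j => ⌊(2 : ℝ) ^ m * Real.sin (2 * π * j / (4 * t : ℕ))⌋⟩, rfl,
    ⟨by have h1 := Int.floor_le ((2 : ℝ) ^ m * Real.sqrt 3); have h2 := Int.lt_floor_add_one ((2 : ℝ) ^ m * Real.sqrt 3)
        rw [abs_le]; constructor <;> linarith,
     fun j _ => by
        have h1 := Int.floor_le ((2 : ℝ) ^ m * Real.cos (2 * π * j / (4 * t : ℕ)))
        have h2 := Int.lt_floor_add_one ((2 : ℝ) ^ m * Real.cos (2 * π * j / (4 * t : ℕ)))
        rw [abs_le]; constructor <;> linarith,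
     fun j _ => by
        have h1 := Int.floor_le ((2 : ℝ) ^ m * Real.sin (2 * π * j / (4 * t : ℕ)))
        have h2 := Int.lt_floor_add_one ((2 : ℝ) ^ m * Real.sin (2 * π * j / (4 * t : ℕ)))
        rw [abs_le]; constructor <;> linarith⟩⟩

/-- The scaled real part `X ≈ 2^m (2 RA₀ − RA₁ − RA₂ − √3 (IA₁ − IA₂))`. [folklore] -/
def Xs (cs : Consts) (C : Idx → ℕ) : ℤ := 2 ^ cs.m * (2 * RA C 0 - RA C 1 - RA C 2) - cs.S3 * (IA C 1 - IA C 2)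

/-- The scaled imaginary part `Y ≈ 2^m (2 IA₀ − IA₁ − IA₂ + √3 (RA₁ − RA₂))`. [folklore] -/
def Ys (cs : Consts) (C : Idx → ℕ) : ℤ := 2 ^ cs.m * (2 * IA C 0 - IA C 1 - IA C 2) + cs.S3 * (RA C 1 - RA C 2)

/-- **The score of grid angle `j`.** [cite: VanDamSeroussi2002, §4 Thm. 1 (proof: estimate γ)] -/
def score (cs : Consts) (C : Idx → ℕ) (j : ℕ) : ℤ := Xs cs C * cs.Cc j + Ys cs C * cs.Sc j

/-- The first maximiser of the scores over `j < T`. [folklore] -/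
def jmax (cs : Consts) (C : Idx → ℕ) : ℕ → ℕ
  | 0 => 0
  | T + 1 => if score cs C (jmax cs C T) < score cs C T then T else jmax cs C T

/-- **The answer** `m = ⌊(ĵ+2)/4⌋ mod t`. [cite: VanDamSeroussi2002, §4 Thm. 1] -/
def outM (cs : Consts) (C : Idx → ℕ) (t : ℕ) : ℕ := (jmax cs C (4 * t) + 2) / 4 % t

/-- The maximiser is in range. [folklore] -/
theorem jmax_lt (cs : Consts) (C : Idx → ℕ) : ∀ {T : ℕ}, 0 < T → jmax cs C T < T
  | 0, h => absurd h (lt_irrefl 0)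
  | T + 1, _ => by
    unfold jmax
    split_ifs
    · exact Nat.lt_succ_self T
    · rcases Nat.eq_zero_or_pos T with rfl | hT
      · exact Nat.zero_lt_one
      · exact (jmax_lt cs C hT).trans (Nat.lt_succ_self T)

/-- The maximiser maximises. [folklore] -/
theorem score_le_jmax (cs : Consts) (C : Idx → ℕ) : ∀ (T j : ℕ), j < T → score cs C j ≤ score cs C (jmax cs C T)
  | 0, _, h => absurd h (Nat.not_lt_zero _)
  | T + 1, j, hj => by
    unfold jmax
    rcases Nat.lt_succ_iff_lt_or_eq.1 hj with hlt | rfl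
    · have := score_le_jmax cs C T j hlt
      split_ifs with h <;> omega
    · split_ifs with h <;> omega

end Post

/-! ### The readers of the measured string -/

namespace Layout

variable (Λ : Layout)

/-- Ones in block `(l, b)` of a list of test bits. [cite: Kitaev1995, §3 (before Lemma 9)] -/
def cntL (ts : List Bool) (l : ℕ) (b : Bool) : ℕ :=
  ((List.range Λ.k).filter fun j => decide (j / Λ.Bper = l) && decide (decide (Λ.B ≤ j % Λ.Bper) = b) && ts.getD j false).length

/-- The quadrant estimate of level `l` from a list. [cite: Kitaev1995, §3 Lemma 10] -/
def levelEstL (ts : List Bool) (l : ℕ) : ℚ :=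
  quadrantCenter (decide (2 * Λ.cntL ts l false ≤ Λ.B)) (decide (2 * Λ.cntL ts l true ≤ Λ.B))

/-- The refined estimate from a list. [cite: Kitaev1995, §3 Lemma 10] -/
def phaseEstL (ts : List Bool) : ℚ := refined (fun l => if l < Λ.kap then Λ.levelEstL ts l else 0) Λ.kap

/-- **The decoded frequency from a list of test bits.** [cite: Kitaev1995, §3 Thm 1] -/
def freqOfL (ts : List Bool) : ℕ := ((round ((Λ.Nmod : ℚ) * Λ.phaseEstL ts)) % (Λ.Nmod : ℤ)).toNat

/-- **The class test by powers**: `x = k_f`, `x ≢ 0 (mod p)` and `x^e ≡ u^c` (`e = (p−1)/3`, `u = r^e`). [cite: IrelandRosen1990, Prop. 9.3.3] -/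
def classOK (p r c f : ℕ) : Bool :=
  !decide (nearIdx Λ.Nmod p f % p = 0) &&
    decide (powM p (nearIdx Λ.Nmod p f) ((p - 1) / 3) = powM p (powM p r ((p - 1) / 3)) c)

/-- **The event `(c, c', τ, b)` of a copy**, read through the bits `bits q` of its block label. [cite: VanDamSeroussi2002, §4 Thm. 1 (proof)] -/
def evL (p r : ℕ) (bits : ℕ → Bool) (i : Idx) : Bool :=
  decide (bits (Λ.CPreg 0) = (i.2.1 : ℕ).testBit 0) && decide (bits (Λ.CPreg 0 + 1) = (i.2.1 : ℕ).testBit 1) &&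
    decide (bits Λ.tau = i.2.2.1) && decide (bits Λ.c = i.2.2.2) &&
    Λ.classOK p r i.1 (Λ.freqOfL ((List.range Λ.k).map fun q => bits (Λ.n₁ + q)))

end Layout

/-- The block width of the experiment. [folklore] -/
def bOf (t n' : ℕ) : ℕ := n' + (widthBound t).eval n' + 2

/-- The number of copies. [folklore] -/
def Kt (t : ℕ) : ℕ := 2 ^ 35 * t ^ 4 + 1

/-- **The counts read off the measured string**: copy `j` is read at `b + 1 + j·b + q`. [cite: VanDamSeroussi2002, §4 Thm. 1 (proof)] -/
def cntS (t p r n' : ℕ) (y : List Bool) (i : Idx) : ℕ :=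
  ((List.range (Kt t)).filter fun j => (lay t n').evL p r (fun q => y.getD (bOf t n' + 1 + j * bOf t n' + q) false) i).length


end CubicBlock

end VanDamSeroussi

end Literature.Computability.Cryptography
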